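import Literature.AlgebraicGeometry.HodgeTheory.ComplexTorusIntegralHodgeClassesKunnethProjectorsProduct
import Literature.AlgebraicGeometry.HodgeTheory.ComplexTorusIntegralHodgeClassesCorrespondenceExteriorProductComposition
import HarnessLib

/-!
# The Künneth projectors of a product, II: `π_{s,X} × π_{t,X′}` are orthogonal idempotents of `Hdg((X × X′) × (X × X′), ℤ)` summing to `[Δ_{X×X′}]`

Sequel of g29-#11 (`ComplexTorusIntegralHodgeClassesKunnethProjectorsProduct`: `π_{n,X×X′} = Σ_{s+t=n} π_{s,X} × π_{t,X′}` with the exterior product of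
correspondences `α × β = q^*α · q′^*β`) and g30-#2 (`ComplexTorusIntegralHodgeClassesCorrespondenceExteriorProductComposition`: the interchange law
`(α′ × β′) ∘ (α × β) = (α′ ∘ α) × (β′ ∘ β)`). For complex tori `X`, `X′` of dimensions `g_X`, `g_{X′}` the `(2g_X + 1)(2g_{X′} + 1)` integral classes
`π_{s,X} × π_{t,X′} ∈ Hdg^{g_X+g_{X′}}((X × X′) × (X × X′), ℤ)` refine the Künneth projectors of `X × X′` into a BIGRADED system of projectors (Fulton Example 16.1.12:
"`(X, p) ⊗ (Y, q) = (X × Y, p × q)`" — the tensor product of the projectors `(X, π_s)`, `(X′, π_t)` of `𝒞𝒱`; Lange §6.3.4 Prop. 6.3.9 (a) for each factor):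

* §1 **`integralHodgeClassesCorrComp_kunnethProjectorCross_kunnethProjectorCross`** — **`(π_{s′,X} × π_{t′,X′}) ∘ (π_{s,X} × π_{t,X′}) = δ_{ss′} δ_{tt′} · (π_{s,X} × π_{t,X′})`**:
  mutually orthogonal idempotents (interchange law + Prop. 6.3.9 (a) `π_{s′} ∘ π_s = δ_{ss′} π_s` on each factor, g29-#5);
* §2 **`sum_sum_kunnethProjectorCross`** — **`Σ_{s ≤ 2g_X} Σ_{t ≤ 2g_{X′}} π_{s,X} × π_{t,X′} = [Δ_{X×X′}]`** (`[Δ_X] × [Δ_{X′}] = [Δ_{X×X′}]`, g29-#4, and `Σ_s π_{s,X} = [Δ_X]`, g29-#5):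
  a complete system, refining `[Δ_{X×X′}] = Σ_n π_{n,X×X′}` (g29-#11: `π_{n,X×X′}` is the sum of the `π_s × π_t` with `s + t = n`);
* §3 **`integralHodgeClassesCorrComp_kunnethProjectorCross_kunnethProjector`** — **`π_{n,X×X′} ∘ (π_{s,X} × π_{t,X′}) = δ_{n,s+t} · (π_{s,X} × π_{t,X′})`**: the piece
  `π_s × π_t` lies in the `nˢ⁺ᵗ`-eigenspace of `(1 × n_{X×X′})^*`, i.e. under `π_{s+t,X×X′}` ((6.15)/(6.17) for `X × X′`; §1 and g29-#11).

Everything is a theorem; no definition, no named fact (D-0026). Frames: `eX`, `eXX`, `eX′`, `eX′X′`, `eXX′`, `ePP` as in g29-#11 (with their rank bookkeeping),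
and arbitrary frames `eT`, `eT′`, `eTP` of `X × (X × X)`, `X′ × (X′ × X′)`, `(X × X′) × ((X × X′) × (X × X′))` for the three compositions.

## References
* [Fulton1998] W. Fulton, Intersection Theory, 2nd ed., Springer 1998, §16.1 Example 16.1.12 (p0300 L9–L12, p0301 L9), Def. 16.1.1 (p0293 L3–L7).
* [Lange2023AbelianVarietiesComplex] H. Lange, Abelian Varieties over the Complex Numbers, Springer 2023, §6.3.4 (p0317 L28–L32), Prop. 6.3.9 (a) (p0318 L1–L6),
  §6.3.3 (6.15)–(6.17).
* [VoisinHodgeI2002] C. Voisin, Hodge Theory and Complex Algebraic Geometry I, CUP 2002, §11.3.3 Thm. 11.38, p. 287.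
-/

noncomputable section

open CategoryTheory Function

namespace Literature.AlgebraicGeometry.HodgeTheory

open Literature.AlgebraicGeometry.Motives Literature.AlgebraicGeometry.Motives.HodgeStructure
open Literature.Geometry.Kaehler Literature.Geometry.Kaehler.ComplexTorus

namespace ComplexTorusCat

section Product

variable (X X' : ComplexTorusCat) {gX gX' gXX gX'X' G GP : ℕ} (hG : gX + gX' = G) (hGG : G + G = GP)
  (eX : Fin (2 * gX) ≃ X.toIsog.ι) (eXX : Fin (2 * gXX) ≃ (prodObj X X).toIsog.ι)
  (hX0 : 2 * gX + 2 * 0 = 2 * gX) (hgX : gX + gX = 2 * gX) (hcX : 2 * gX + 2 * gX = 2 * gXX) (hgXX : gXX + gXX = 2 * gXX) (hggX : gX + gX = gXX)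
  (eX' : Fin (2 * gX') ≃ X'.toIsog.ι) (eX'X' : Fin (2 * gX'X') ≃ (prodObj X' X').toIsog.ι)
  (hX'0 : 2 * gX' + 2 * 0 = 2 * gX') (hgX' : gX' + gX' = 2 * gX') (hcX' : 2 * gX' + 2 * gX' = 2 * gX'X') (hgX'X' : gX'X' + gX'X' = 2 * gX'X')
  (hggX' : gX' + gX' = gX'X')
  (eXX' : Fin (2 * G) ≃ (prodObj X X').toIsog.ι) (ePP : Fin (2 * GP) ≃ (prodObj (prodObj X X') (prodObj X X')).toIsog.ι)
  (hP0 : 2 * G + 2 * 0 = 2 * G) (hgP : G + G = 2 * G) (hcP : 2 * G + 2 * G = 2 * GP) (hgPP : GP + GP = 2 * GP)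
  {nT nT' nTP gT gT' gTP : ℕ} (eT : Fin nT ≃ (prodObj X (prodObj X X)).toIsog.ι) (h3 : 2 * gX + 2 * gXX = nT) (hgT : gT + gT = nT)
  (eT' : Fin nT' ≃ (prodObj X' (prodObj X' X')).toIsog.ι) (h3b : 2 * gX' + 2 * gX'X' = nT') (hgT' : gT' + gT' = nT')
  (eTP : Fin nTP ≃ (prodObj (prodObj X X') (prodObj (prodObj X X') (prodObj X X'))).toIsog.ι) (H3 : 2 * G + 2 * GP = nTP) (hgTP : gTP + gTP = nTP)

/-! ### §1 `(π_{s′,X} × π_{t′,X′}) ∘ (π_{s,X} × π_{t,X′}) = δ_{ss′} δ_{tt′} · (π_{s,X} × π_{t,X′})` -/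

include eT eT' h3 hgT h3b hgT' hggX hggX' in
/-- **`(π_{s′,X} × π_{t′,X′}) ∘ (π_{s,X} × π_{t,X′}) = δ_{ss′} δ_{tt′} · (π_{s,X} × π_{t,X′})`** in `Hdg^{g_X+g_{X′}}((X × X′) × (X × X′), ℤ)`: the exterior products of the
Künneth projectors of the factors are mutually orthogonal idempotent correspondences of `X × X′` (Fulton's composition on `(X × X′) × ((X × X′) × (X × X′))`,
any frame `eTP`). Proof: the interchange law (g30-#2) and Prop. 6.3.9 (a) `π_{s′} ∘ π_s = δ_{ss′} π_s` on `X` and on `X′` (g29-#5, composites in the frames `eT`,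
`eT′`). [cite: Fulton1998, §16.1 Example 16.1.12 (p0300 L9–L12, p0301 L9)] [cite: Lange2023AbelianVarietiesComplex, §6.3.4 Prop. 6.3.9 (a) (p0318 L1–L6)] -/
theorem integralHodgeClassesCorrComp_kunnethProjectorCross_kunnethProjectorCross (s t s' t' : ℕ) :
    integralHodgeClassesPushforward GP G
        (liftHom (fstHom (prodObj X X') (prodObj (prodObj X X') (prodObj X X')))
          (sndHom (prodObj X X') (prodObj (prodObj X X') (prodObj X X')) ≫ sndHom (prodObj X X') (prodObj X X'))) eTP ePP H3 hgTP hcP hgPP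
        (integralHodgeClassesCup (prodObj (prodObj X X') (prodObj (prodObj X X') (prodObj X X'))).toIsog.Φ hGG
          (integralHodgeClassesPullbackHom
            (liftHom (fstHom (prodObj X X') (prodObj (prodObj X X') (prodObj X X')))
              (sndHom (prodObj X X') (prodObj (prodObj X X') (prodObj X X')) ≫ fstHom (prodObj X X') (prodObj X X'))) G
            (integralHodgeClassesCup (prodObj (prodObj X X') (prodObj X X')).toIsog.Φ hG
              (integralHodgeClassesPullbackHom
                (liftHom (fstHom (prodObj X X') (prodObj X X') ≫ fstHom X X') (sndHom (prodObj X X') (prodObj X X') ≫ fstHom X X')) gX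
                (kunnethProjector X eX eXX hX0 hgX hcX hgXX s))
              (integralHodgeClassesPullbackHom
                (liftHom (fstHom (prodObj X X') (prodObj X X') ≫ sndHom X X') (sndHom (prodObj X X') (prodObj X X') ≫ sndHom X X')) gX'
                (kunnethProjector X' eX' eX'X' hX'0 hgX' hcX' hgX'X' t))))
          (integralHodgeClassesPullbackHom (sndHom (prodObj X X') (prodObj (prodObj X X') (prodObj X X'))) G
            (integralHodgeClassesCup (prodObj (prodObj X X') (prodObj X X')).toIsog.Φ hG
              (integralHodgeClassesPullbackHom
                (liftHom (fstHom (prodObj X X') (prodObj X X') ≫ fstHom X X') (sndHom (prodObj X X') (prodObj X X') ≫ fstHom X X')) gX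
                (kunnethProjector X eX eXX hX0 hgX hcX hgXX s'))
              (integralHodgeClassesPullbackHom
                (liftHom (fstHom (prodObj X X') (prodObj X X') ≫ sndHom X X') (sndHom (prodObj X X') (prodObj X X') ≫ sndHom X X')) gX'
                (kunnethProjector X' eX' eX'X' hX'0 hgX' hcX' hgX'X' t'))))) =
      if s = s' ∧ t = t' then
        integralHodgeClassesCup (prodObj (prodObj X X') (prodObj X X')).toIsog.Φ hG
          (integralHodgeClassesPullbackHom
            (liftHom (fstHom (prodObj X X') (prodObj X X') ≫ fstHom X X') (sndHom (prodObj X X') (prodObj X X') ≫ fstHom X X')) gX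
            (kunnethProjector X eX eXX hX0 hgX hcX hgXX s))
          (integralHodgeClassesPullbackHom
            (liftHom (fstHom (prodObj X X') (prodObj X X') ≫ sndHom X X') (sndHom (prodObj X X') (prodObj X X') ≫ sndHom X X')) gX'
            (kunnethProjector X' eX' eX'X' hX'0 hgX' hcX' hgX'X' t))
      else 0 := by
  rw [integralHodgeClassesCorrComp_corrCross_corrCross eT eXX eT' eX'X' eTP ePP (show nTP = nT + nT' by omega) (show 2 * GP = 2 * gXX + 2 * gX'X' by omega)
      hgT hgXX hgT' hgX'X' hgTP hgPP hggX hggX' hG hG hGG hG h3 hcX h3b hcX' H3 hcP,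
    integralHodgeClassesCorrComp_kunnethProjector_kunnethProjector X eX eXX hX0 hgX hcX hgXX eT hggX h3 hgT s s',
    integralHodgeClassesCorrComp_kunnethProjector_kunnethProjector X' eX' eX'X' hX'0 hgX' hcX' hgX'X' eT' hggX' h3b hgT' t t']
  by_cases hs : s = s'
  · by_cases ht : t = t'
    · rw [if_pos hs, if_pos ht, if_pos ⟨hs, ht⟩]
    · rw [if_neg ht, if_neg (show ¬(s = s' ∧ t = t') from fun h ↦ ht h.2), map_zero, map_zero]
  · rw [if_neg hs, if_neg (show ¬(s = s' ∧ t = t') from fun h ↦ hs h.1), map_zero, map_zero, AddMonoidHom.zero_apply]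

include eT eT' h3 hgT h3b hgT' hggX hggX' in
/-- **`(π_{s,X} × π_{t,X′}) ∘ (π_{s,X} × π_{t,X′}) = π_{s,X} × π_{t,X′}`**: each piece is an idempotent correspondence of `X × X′`.
[cite: Fulton1998, §16.1 Example 16.1.12 (p0301 L9)] [cite: Lange2023AbelianVarietiesComplex, §6.3.4 Prop. 6.3.9 (a) (p0318 L1–L6)] -/
theorem integralHodgeClassesCorrComp_kunnethProjectorCross_self (s t : ℕ) :
    integralHodgeClassesPushforward GP G
        (liftHom (fstHom (prodObj X X') (prodObj (prodObj X X') (prodObj X X')))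
          (sndHom (prodObj X X') (prodObj (prodObj X X') (prodObj X X')) ≫ sndHom (prodObj X X') (prodObj X X'))) eTP ePP H3 hgTP hcP hgPP
        (integralHodgeClassesCup (prodObj (prodObj X X') (prodObj (prodObj X X') (prodObj X X'))).toIsog.Φ hGG
          (integralHodgeClassesPullbackHom
            (liftHom (fstHom (prodObj X X') (prodObj (prodObj X X') (prodObj X X')))
              (sndHom (prodObj X X') (prodObj (prodObj X X') (prodObj X X')) ≫ fstHom (prodObj X X') (prodObj X X'))) G
            (integralHodgeClassesCup (prodObj (prodObj X X') (prodObj X X')).toIsog.Φ hG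
              (integralHodgeClassesPullbackHom
                (liftHom (fstHom (prodObj X X') (prodObj X X') ≫ fstHom X X') (sndHom (prodObj X X') (prodObj X X') ≫ fstHom X X')) gX
                (kunnethProjector X eX eXX hX0 hgX hcX hgXX s))
              (integralHodgeClassesPullbackHom
                (liftHom (fstHom (prodObj X X') (prodObj X X') ≫ sndHom X X') (sndHom (prodObj X X') (prodObj X X') ≫ sndHom X X')) gX'
                (kunnethProjector X' eX' eX'X' hX'0 hgX' hcX' hgX'X' t))))
          (integralHodgeClassesPullbackHom (sndHom (prodObj X X') (prodObj (prodObj X X') (prodObj X X'))) G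
            (integralHodgeClassesCup (prodObj (prodObj X X') (prodObj X X')).toIsog.Φ hG
              (integralHodgeClassesPullbackHom
                (liftHom (fstHom (prodObj X X') (prodObj X X') ≫ fstHom X X') (sndHom (prodObj X X') (prodObj X X') ≫ fstHom X X')) gX
                (kunnethProjector X eX eXX hX0 hgX hcX hgXX s))
              (integralHodgeClassesPullbackHom
                (liftHom (fstHom (prodObj X X') (prodObj X X') ≫ sndHom X X') (sndHom (prodObj X X') (prodObj X X') ≫ sndHom X X')) gX'
                (kunnethProjector X' eX' eX'X' hX'0 hgX' hcX' hgX'X' t))))) =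
      integralHodgeClassesCup (prodObj (prodObj X X') (prodObj X X')).toIsog.Φ hG
        (integralHodgeClassesPullbackHom
          (liftHom (fstHom (prodObj X X') (prodObj X X') ≫ fstHom X X') (sndHom (prodObj X X') (prodObj X X') ≫ fstHom X X')) gX
          (kunnethProjector X eX eXX hX0 hgX hcX hgXX s))
        (integralHodgeClassesPullbackHom
          (liftHom (fstHom (prodObj X X') (prodObj X X') ≫ sndHom X X') (sndHom (prodObj X X') (prodObj X X') ≫ sndHom X X')) gX'
          (kunnethProjector X' eX' eX'X' hX'0 hgX' hcX' hgX'X' t)) := by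
  rw [integralHodgeClassesCorrComp_kunnethProjectorCross_kunnethProjectorCross X X' hG hGG eX eXX hX0 hgX hcX hgXX hggX eX' eX'X' hX'0 hgX' hcX' hgX'X' hggX' ePP hcP hgPP
      eT h3 hgT eT' h3b hgT' eTP H3 hgTP, if_pos ⟨rfl, rfl⟩]

/-! ### §2 `Σ_s Σ_t π_{s,X} × π_{t,X′} = [Δ_{X×X′}]` -/

/-- **`Σ_{s ≤ 2g_X} Σ_{t ≤ 2g_{X′}} π_{s,X} × π_{t,X′} = [Δ_{X×X′}]`**: the pieces form a complete system of orthogonal idempotents of the ring of correspondences of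
`X × X′` — `[Δ_{X×X′}] = [Δ_X] × [Δ_{X′}]` (g29-#4) and the Künneth decompositions `[Δ_X] = Σ_s π_{s,X}`, `[Δ_{X′}] = Σ_t π_{t,X′}` (g29-#5), by bi-additivity of `×`.
[cite: Lange2023AbelianVarietiesComplex, §6.3.4 (p0317 L28–L32)] [cite: Fulton1998, §16.1 Example 16.1.12 (p0300 L9–L12) and Cor. 16.1.1 (p0295 L7)] -/
theorem sum_sum_kunnethProjectorCross :
    ∑ s ∈ Finset.range (2 * gX + 1), ∑ t ∈ Finset.range (2 * gX' + 1),
        integralHodgeClassesCup (prodObj (prodObj X X') (prodObj X X')).toIsog.Φ hG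
          (integralHodgeClassesPullbackHom
            (liftHom (fstHom (prodObj X X') (prodObj X X') ≫ fstHom X X') (sndHom (prodObj X X') (prodObj X X') ≫ fstHom X X')) gX
            (kunnethProjector X eX eXX hX0 hgX hcX hgXX s))
          (integralHodgeClassesPullbackHom
            (liftHom (fstHom (prodObj X X') (prodObj X X') ≫ sndHom X X') (sndHom (prodObj X X') (prodObj X X') ≫ sndHom X X')) gX'
            (kunnethProjector X' eX' eX'X' hX'0 hgX' hcX' hgX'X' t)) =
      integralHodgeClassesPushforward 0 G (diagHom (prodObj X X')) eXX' ePP hP0 hgP hcP hgPP (unitIntegralHodgeClass (prodObj X X')) := by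
  rw [integralHodgeClassesPushforward_diagHom_prod_unitIntegralHodgeClass X X' eX eX' eXX' hX0 hgX hX'0 hgX' hP0 hgP hG eX eX' eXX eX'X' eXX' ePP hcX hgXX hcX'
      hgX'X' hcP hgPP, ← sum_range_kunnethProjector X eX eXX hX0 hgX hcX hgXX, ← sum_range_kunnethProjector X' eX' eX'X' hX'0 hgX' hcX' hgX'X', map_sum, map_sum,
    map_sum, AddMonoidHom.finsetSum_apply]
  exact Finset.sum_congr rfl fun s _ ↦ (map_sum _ _ _).symm

/-! ### §3 `π_{n,X×X′} ∘ (π_{s,X} × π_{t,X′}) = δ_{n,s+t} · (π_{s,X} × π_{t,X′})` -/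

set_option maxHeartbeats 800000 in
include eT eT' h3 hgT h3b hgT' hggX hggX' in
/-- **`π_{n,X×X′} ∘ (π_{s,X} × π_{t,X′}) = δ_{n,s+t} · (π_{s,X} × π_{t,X′})`**: the piece `π_{s,X} × π_{t,X′}` is fixed by the Künneth projector `π_{s+t,X×X′}` of the product and
killed by the others — it lies in the eigenspace `(1 × n_{X×X′})^* = nˢ⁺ᵗ` ((6.15), Prop. 6.3.11 for `X × X′`). Proof: `π_{n,X×X′} = Σ_{s′+t′=n} π_{s′,X} × π_{t′,X′}`
(g29-#11) and §1. [cite: Lange2023AbelianVarietiesComplex, §6.3.3 (6.15)–(6.16) (p0317 L6–L17) and §6.3.4 Prop. 6.3.11 (p0319 L9–L12)] [cite: Fulton1998, §16.1 Example 16.1.12 (p0301 L9)] -/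
theorem integralHodgeClassesCorrComp_kunnethProjectorCross_kunnethProjector (n s t : ℕ) :
    integralHodgeClassesPushforward GP G
        (liftHom (fstHom (prodObj X X') (prodObj (prodObj X X') (prodObj X X')))
          (sndHom (prodObj X X') (prodObj (prodObj X X') (prodObj X X')) ≫ sndHom (prodObj X X') (prodObj X X'))) eTP ePP H3 hgTP hcP hgPP
        (integralHodgeClassesCup (prodObj (prodObj X X') (prodObj (prodObj X X') (prodObj X X'))).toIsog.Φ hGG
          (integralHodgeClassesPullbackHom
            (liftHom (fstHom (prodObj X X') (prodObj (prodObj X X') (prodObj X X')))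
              (sndHom (prodObj X X') (prodObj (prodObj X X') (prodObj X X')) ≫ fstHom (prodObj X X') (prodObj X X'))) G
            (integralHodgeClassesCup (prodObj (prodObj X X') (prodObj X X')).toIsog.Φ hG
              (integralHodgeClassesPullbackHom
                (liftHom (fstHom (prodObj X X') (prodObj X X') ≫ fstHom X X') (sndHom (prodObj X X') (prodObj X X') ≫ fstHom X X')) gX
                (kunnethProjector X eX eXX hX0 hgX hcX hgXX s))
              (integralHodgeClassesPullbackHom
                (liftHom (fstHom (prodObj X X') (prodObj X X') ≫ sndHom X X') (sndHom (prodObj X X') (prodObj X X') ≫ sndHom X X')) gX'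
                (kunnethProjector X' eX' eX'X' hX'0 hgX' hcX' hgX'X' t))))
          (integralHodgeClassesPullbackHom (sndHom (prodObj X X') (prodObj (prodObj X X') (prodObj X X'))) G
            (kunnethProjector (prodObj X X') eXX' ePP hP0 hgP hcP hgPP n))) =
      if n = s + t then
        integralHodgeClassesCup (prodObj (prodObj X X') (prodObj X X')).toIsog.Φ hG
          (integralHodgeClassesPullbackHom
            (liftHom (fstHom (prodObj X X') (prodObj X X') ≫ fstHom X X') (sndHom (prodObj X X') (prodObj X X') ≫ fstHom X X')) gX
            (kunnethProjector X eX eXX hX0 hgX hcX hgXX s))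
          (integralHodgeClassesPullbackHom
            (liftHom (fstHom (prodObj X X') (prodObj X X') ≫ sndHom X X') (sndHom (prodObj X X') (prodObj X X') ≫ sndHom X X')) gX'
            (kunnethProjector X' eX' eX'X' hX'0 hgX' hcX' hgX'X' t))
      else 0 := by
  by_cases hs : 2 * gX < s
  · rw [kunnethProjector_eq_zero_of_lt X eX eXX hX0 hgX hcX hgXX hs, map_zero, map_zero, AddMonoidHom.zero_apply, map_zero, map_zero, AddMonoidHom.zero_apply,
      map_zero, ite_self]
  by_cases ht : 2 * gX' < t
  · rw [kunnethProjector_eq_zero_of_lt X' eX' eX'X' hX'0 hgX' hcX' hgX'X' ht, map_zero, map_zero, map_zero, map_zero, AddMonoidHom.zero_apply, map_zero,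
      ite_self]
  rw [kunnethProjector_prod X X' hG eX eXX hX0 hgX hcX hgXX eX' eX'X' hX'0 hgX' hcX' hgX'X' eXX' ePP hP0 hgP hcP hgPP n, map_sum, map_sum, map_sum,
    Finset.sum_eq_single_of_mem s (Finset.mem_range.2 (by omega)) fun s' _ hs' ↦ ?_]
  · rw [map_sum, map_sum, map_sum, Finset.sum_eq_single_of_mem t (Finset.mem_range.2 (by omega)) fun t' _ ht' ↦ ?_]
    · by_cases hn : n = s + t
      · rw [if_pos hn,
          integralHodgeClassesCorrComp_kunnethProjectorCross_self X X' hG hGG eX eXX hX0 hgX hcX hgXX hggX eX' eX'X' hX'0 hgX' hcX' hgX'X' hggX' ePP hcP hgPP eT h3 hgT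
            eT' h3b hgT' eTP H3 hgTP]
      · rw [if_neg hn, map_zero, map_zero, map_zero]
    · split_ifs
      · rw [integralHodgeClassesCorrComp_kunnethProjectorCross_kunnethProjectorCross X X' hG hGG eX eXX hX0 hgX hcX hgXX hggX eX' eX'X' hX'0 hgX' hcX' hgX'X' hggX'
            ePP hcP hgPP eT h3 hgT eT' h3b hgT' eTP H3 hgTP s t s t', if_neg (show ¬(s = s ∧ t = t') from fun h ↦ ht' h.2.symm)]
      · rw [map_zero, map_zero, map_zero]
  · rw [map_sum, map_sum, map_sum]
    refine Finset.sum_eq_zero fun t' _ ↦ ?_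
    split_ifs
    · rw [integralHodgeClassesCorrComp_kunnethProjectorCross_kunnethProjectorCross X X' hG hGG eX eXX hX0 hgX hcX hgXX hggX eX' eX'X' hX'0 hgX' hcX' hgX'X' hggX'
          ePP hcP hgPP eT h3 hgT eT' h3b hgT' eTP H3 hgTP s t s' t', if_neg (show ¬(s = s' ∧ t = t') from fun h ↦ hs' h.1.symm)]
    · rw [map_zero, map_zero, map_zero]

end Product

end ComplexTorusCat

end Literature.AlgebraicGeometry.HodgeTheory
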